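import Summits.CriticalPhenomena.SAWScalingLimit.Theorems.SAWDefectDecoherencePickHalfPlaneDefs
import Literature.Probability.LatticeModels.TriangularLatticeReflection
import HarnessLib

/-!
# Crux `BoundaryClosureR` (stmt-CriticalPhenomena-14004), line `pick-half-plane`:
the star identity — consecutive hexagon edge values differ by twice the conjugated star defect

Lead helper file (serves `stub_halfPlaneInputs`, interior half `HexNoInteriorMax`; companion of
`…BoundaryClosureRHexagonOscillation.lean`).  At a vertex `v` of `ℍ` with its three mid-edges
`p, q, o` write the two star sums `V(v) = Σ (mid − c_v)·F` (DCS's vertex relation, Lemma 1: `= 0`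
for the observable) and `D(v) = Σ conj(mid − c_v)·F` (the CONJUGATED star sum — the quantity the
route's crux `DefectDecoherence` controls at depth).  The three values of `F` decompose as
`F = P + Q·n` over the three unit directions `n`, with `V ∝` the missing third Fourier mode and
`D = (√3/2)·(1/√3)·3Q`; hence for the two HEXAGON edges at the corner `face_{k+1}` of the hexagon
around a site:

  `F(edge_k) − F(edge_{k+1}) = 2ζ^k · D(face_{k+1}) + 2ζ^{−k} · V(face_{k+1})`   (`star_identity`)

(`ζ = e^{iπ/3}`), an exact lattice identity; with Lemma 1, `‖F(edge_k) − F(edge_{k+1})‖ = 2‖D‖`: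
the observable varies around a hexagon by at most twice the conjugated defects of its corners
(`norm_edge_sub_edge_succ_le`), so around the whole hexagon by `≤ 10·max‖D‖`
(`norm_edge_sub_edge_zero_le`).  Combined with the central-symmetry lemma
`noInteriorMax_of_oscillation` this is the formal content of "the interior half of Claim D is
automatic in the bulk under `DefectDecoherence`": a hexagon at depth `R` whose corner defects are
`< ‖F‖/(30√2)` has a neighbour with larger `Re H`.
-/

noncomputable section

open scoped BigOperators ComplexConjugate
open Literature.Probability.LatticeModels Literature.Probability.RandomPlanarGeometry
open Literature.Probability.RandomPlanarGeometry.SAW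
open Literature.Barriers.CriticalPhenomena Literature.Barriers.CriticalPhenomena.HexKernel
open Summit.CriticalPhenomena.SAWScalingLimit.Theorems.PickHalfPlane

namespace Summit.CriticalPhenomena.SAWScalingLimit.Theorems.PickHalfPlane.StarDefect

/-! ### The three half-edge vectors at the corner `face x (k+1)` of the hexagon around `x` -/

/-- Towards the previous corner: `mid(edge_k) − c(face_{k+1}) = −(c_{k+1} − c_k)/2`, explicitly
`(−b, a, −c, b, −a, c)/2`. [folklore] -/
theorem hexMidpoint_edge_sub_face_succ (x : Site 2) (k : Fin 6) :
    hexMidpoint (edge x k) - hexCenter (face x (k + 1)) =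
      (![-vecB, vecA, -vecC, vecB, -vecA, vecC] k) / 2 := by
  fin_cases k <;>
    (simp [edge, face, hexCenter_mk, HexKernel.triEmbed_sub, vecA, vecB, vecC]; ring)

/-- Towards the next corner: `mid(edge_{k+1}) − c(face_{k+1}) = (c_{k+2} − c_{k+1})/2`, explicitly
`(−a, c, −b, a, −c, b)/2`. [folklore] -/
theorem hexMidpoint_edge_succ_sub_face_succ (x : Site 2) (k : Fin 6) :
    hexMidpoint (edge x (k + 1)) - hexCenter (face x (k + 1)) =
      (![-vecA, vecC, -vecB, vecA, -vecC, vecB] k) / 2 := by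
  fin_cases k <;>
    (simp [edge, face, hexCenter_mk, HexKernel.triEmbed_sub, vecA, vecB, vecC]; ring)

/-- The radial half-edge: `mid{face_{k+1}, outFace_{k+1}} − c(face_{k+1})`, explicitly
`(−c, b, −a, c, −b, a)/2`. [folklore] -/
theorem hexMidpoint_radial_sub_face_succ (x : Site 2) (k : Fin 6) :
    hexMidpoint s(face x (k + 1), outFace x (k + 1)) - hexCenter (face x (k + 1)) =
      (![-vecC, vecB, -vecA, vecC, -vecB, vecA] k) / 2 := by
  fin_cases k <;>
    (simp [face, outFace, hexCenter_mk, HexKernel.triEmbed_sub,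
      Literature.Probability.LatticeModels.triEmbed_add, vecA, vecB, vecC]; ring)

/-- Conjugates of the lattice vectors: `conj a = (2 − ζ)/3`, `conj b = (−1 − ζ)/3`,
`conj c = (−1 + 2ζ)/3` (`conj ζ = 1 − ζ`). [folklore] -/
theorem conj_vecA : conj vecA = (2 - triZeta) / 3 := by
  simp only [vecA, map_div₀, map_add, map_one, conj_triZeta, map_ofNat]; ring

/-- `conj b = (−1 − ζ)/3`. [folklore] -/
theorem conj_vecB : conj vecB = (-1 - triZeta) / 3 := by
  simp only [vecB, vecA, map_sub, map_div₀, map_add, map_one, conj_triZeta, map_ofNat]; ring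

/-- `conj c = (−1 + 2ζ)/3`. [folklore] -/
theorem conj_vecC : conj vecC = (-1 + 2 * triZeta) / 3 := by
  simp only [vecC, vecA, map_sub, map_div₀, map_add, map_one, conj_triZeta, map_ofNat]; ring

/-! ### The two star sums at a hexagon corner -/

/-- The vertex star sum `V(v) = Σ (mid − c_v)·F` over the three mid-edges at the corner
`v = face x (k+1)` (hexagon edges `edge_k`, `edge_{k+1}` and the radial edge): DCS's relation (1)
says `V = 0` for the critical observable. [cite: DuminilCopinSmirnov2012, Lemma 1] -/
def starSum (F : Sym2 HexVertex → ℂ) (x : Site 2) (k : Fin 6) : ℂ :=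
  (hexMidpoint (edge x k) - hexCenter (face x (k + 1))) * F (edge x k) +
    (hexMidpoint (edge x (k + 1)) - hexCenter (face x (k + 1))) * F (edge x (k + 1)) +
    (hexMidpoint s(face x (k + 1), outFace x (k + 1)) - hexCenter (face x (k + 1))) *
      F s(face x (k + 1), outFace x (k + 1))

/-- The CONJUGATED star sum `D(v) = Σ conj(mid − c_v)·F` at the corner `v = face x (k+1)` — the
"missing half" of discrete Cauchy–Riemann at `v`, the summand of the route's `DefectDecoherence`.
[cite: DuminilCopinSmirnov2012, §4] -/
def conjStarSum (F : Sym2 HexVertex → ℂ) (x : Site 2) (k : Fin 6) : ℂ :=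
  conj (hexMidpoint (edge x k) - hexCenter (face x (k + 1))) * F (edge x k) +
    conj (hexMidpoint (edge x (k + 1)) - hexCenter (face x (k + 1))) * F (edge x (k + 1)) +
    conj (hexMidpoint s(face x (k + 1), outFace x (k + 1)) - hexCenter (face x (k + 1))) *
      F s(face x (k + 1), outFace x (k + 1))

/-! ### The star identity -/

/-- **The star identity** at the corner `face x (k+1)` of the hexagon around `x`: for ANY edge
function `F`,
`F(edge_k) − F(edge_{k+1}) = c₁(k)·D + c₂(k)·V` with `c₁ = 2ζ^k = (2, 2ζ, 2ζ−2, −2, −2ζ, 2−2ζ)`,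
`c₂ = 2ζ^{−k} = (2, 2−2ζ, −2ζ, −2, 2ζ−2, 2ζ)`, where `V` is the vertex star sum
`Σ (mid − c_v)F` over the three mid-edges at `v = face x (k+1)` and `D` the conjugated star sum
`Σ conj(mid − c_v)F`.  Pure lattice algebra in `ℚ(ζ)` (`ζ² = ζ − 1`). [folklore] -/
theorem star_identity (F : Sym2 HexVertex → ℂ) (x : Site 2) (k : Fin 6) :
    F (edge x k) - F (edge x (k + 1)) =
      (![2, 2 * triZeta, 2 * triZeta - 2, -2, -2 * triZeta, 2 - 2 * triZeta] k) * conjStarSum F x k +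
        (![2, 2 - 2 * triZeta, -2 * triZeta, -2, 2 * triZeta - 2, 2 * triZeta] k) * starSum F x k := by
  unfold conjStarSum starSum
  rw [hexMidpoint_edge_sub_face_succ, hexMidpoint_edge_succ_sub_face_succ,
    hexMidpoint_radial_sub_face_succ]
  have hz := triZeta_sq
  -- generic names for the three values
  set A : ℂ := F (edge x k)
  set B : ℂ := F (edge x (k + 1))
  set C : ℂ := F s(face x (k + 1), outFace x (k + 1))
  fin_cases k
  · simp [map_div₀, map_neg, vecA, vecB, vecC, map_ofNat, conj_triZeta]
    linear_combination (0 : ℂ) * hz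
  · simp [map_div₀, vecA, vecB, vecC, map_ofNat, conj_triZeta]
    linear_combination ((2 / 3 : ℂ) * A - (4 / 3 : ℂ) * B + (2 / 3 : ℂ) * C) * hz
  · simp [map_div₀, map_neg, vecA, vecB, vecC, map_ofNat, conj_triZeta]
    linear_combination ((4 / 3 : ℂ) * A - (2 / 3 : ℂ) * B - (2 / 3 : ℂ) * C) * hz
  · simp [map_div₀, vecA, vecB, vecC, map_ofNat, conj_triZeta]
    linear_combination (0 : ℂ) * hz
  · simp [map_div₀, map_neg, vecA, vecB, vecC, map_ofNat, conj_triZeta]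
    linear_combination ((2 / 3 : ℂ) * A - (4 / 3 : ℂ) * B + (2 / 3 : ℂ) * C) * hz
  · simp [map_div₀, vecA, vecB, vecC, map_ofNat, conj_triZeta]
    linear_combination ((4 / 3 : ℂ) * A - (2 / 3 : ℂ) * B - (2 / 3 : ℂ) * C) * hz

/-! ### Consequences: the observable varies around a hexagon by at most twice the corner defects -/

/-- The coefficients have modulus `2` (`|2ζ^{±k}| = 2`). [folklore] -/
theorem norm_coeff₁ (k : Fin 6) :
    ‖(![2, 2 * triZeta, 2 * triZeta - 2, -2, -2 * triZeta, 2 - 2 * triZeta] k : ℂ)‖ = 2 := by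
  have h3 : Real.sqrt 3 * Real.sqrt 3 = 3 := Real.mul_self_sqrt (by norm_num)
  have key : ∀ z : ℂ, Complex.normSq z = 4 → ‖z‖ = 2 := fun z hz => by
    rw [← Real.sqrt_sq (norm_nonneg z), ← Complex.normSq_eq_norm_sq, hz]
    rw [show (4 : ℝ) = 2 ^ 2 by norm_num, Real.sqrt_sq (by norm_num : (0 : ℝ) ≤ 2)]
  fin_cases k <;> (apply key; simp [Complex.normSq_apply]; nlinarith [h3])

/-- The second coefficient table has modulus `2` as well. [folklore] -/
theorem norm_coeff₂ (k : Fin 6) :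
    ‖(![2, 2 - 2 * triZeta, -2 * triZeta, -2, 2 * triZeta - 2, 2 * triZeta] k : ℂ)‖ = 2 := by
  have h3 : Real.sqrt 3 * Real.sqrt 3 = 3 := Real.mul_self_sqrt (by norm_num)
  have key : ∀ z : ℂ, Complex.normSq z = 4 → ‖z‖ = 2 := fun z hz => by
    rw [← Real.sqrt_sq (norm_nonneg z), ← Complex.normSq_eq_norm_sq, hz]
    rw [show (4 : ℝ) = 2 ^ 2 by norm_num, Real.sqrt_sq (by norm_num : (0 : ℝ) ≤ 2)]
  fin_cases k <;> (apply key; simp [Complex.normSq_apply]; nlinarith [h3])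

/-- **Consecutive hexagon edge values differ by twice the two star sums**:
`‖F(edge_k) − F(edge_{k+1})‖ ≤ 2‖D‖ + 2‖V‖`. [folklore] -/
theorem norm_edge_sub_edge_succ_le (F : Sym2 HexVertex → ℂ) (x : Site 2) (k : Fin 6) :
    ‖F (edge x k) - F (edge x (k + 1))‖ ≤ 2 * ‖conjStarSum F x k‖ + 2 * ‖starSum F x k‖ := by
  rw [star_identity F x k]
  calc _ ≤ ‖(![2, 2 * triZeta, 2 * triZeta - 2, -2, -2 * triZeta, 2 - 2 * triZeta] k : ℂ) *
            conjStarSum F x k‖ +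
          ‖(![2, 2 - 2 * triZeta, -2 * triZeta, -2, 2 * triZeta - 2, 2 * triZeta] k : ℂ) *
            starSum F x k‖ := norm_add_le _ _
    _ = 2 * ‖conjStarSum F x k‖ + 2 * ‖starSum F x k‖ := by
          rw [norm_mul, norm_mul, norm_coeff₁, norm_coeff₂]

/-- The vertex star sum at a corner IN the domain vanishes for any solution of the vertex
relations (in particular for the critical observable, DCS Lemma 1): `V(face_{k+1}) = 0`.
[cite: DuminilCopinSmirnov2012, Lemma 1] -/
theorem starSum_eq_zero {Λ : Finset HexVertex} {F : Sym2 HexVertex → ℂ}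
    (hF : SatisfiesVertexRelations Λ F) (x : Site 2) (k : Fin 6) (hv : face x (k + 1) ∈ Λ) :
    starSum F x k = 0 := by
  have h := edgeValue_succ_sub hF x k hv
  have hmid : hexMidpoint (edge x (k + 1)) - hexCenter (face x (k + 1)) =
      -(hexMidpoint (edge x (k + 1)) - hexCenter (face x (k + 1 + 1))) := by
    unfold HexKernel.edge
    rw [hexMidpoint_mk]; ring
  unfold starSum
  rw [hmid]
  simp only [edgeValue, HexKernel.term] at h
  linear_combination -h

/-- Under the vertex relations, `‖F(edge_k) − F(edge_{k+1})‖ ≤ 2‖D(face_{k+1})‖`. [folklore] -/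
theorem norm_edge_sub_edge_succ_le_of_relations {Λ : Finset HexVertex} {F : Sym2 HexVertex → ℂ}
    (hF : SatisfiesVertexRelations Λ F) (x : Site 2) (k : Fin 6) (hv : face x (k + 1) ∈ Λ) :
    ‖F (edge x k) - F (edge x (k + 1))‖ ≤ 2 * ‖conjStarSum F x k‖ := by
  have h := norm_edge_sub_edge_succ_le F x k
  rwa [starSum_eq_zero hF x k hv, norm_zero, mul_zero, add_zero] at h

/-- **Oscillation around a hexagon** whose six corners are in the domain: if the six conjugated
star defects are `≤ d`, every edge value is within `6d` of `F(edge_0)` (at most three corners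
separate any edge from `edge_0`). [folklore] -/
theorem norm_edge_sub_edge_zero_le {Λ : Finset HexVertex} {F : Sym2 HexVertex → ℂ}
    (hF : SatisfiesVertexRelations Λ F) (x : Site 2) (hv : ∀ j : Fin 6, face x j ∈ Λ) {d : ℝ}
    (hd : ∀ j : Fin 6, ‖conjStarSum F x j‖ ≤ d) (k : Fin 6) :
    ‖F (edge x k) - F (edge x 0)‖ ≤ 6 * d := by
  have step : ∀ j : Fin 6, ‖F (edge x j) - F (edge x (j + 1))‖ ≤ 2 * d := fun j =>
    (norm_edge_sub_edge_succ_le_of_relations hF x j (hv _)).trans (by linarith [hd j])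
  have d0 : 0 ≤ d := le_trans (norm_nonneg _) (hd 0)
  have s0 := step 0; have s1 := step 1; have s2 := step 2; have s3 := step 3; have s4 := step 4
  have s5 := step 5
  simp only [Fin.isValue, show (0 : Fin 6) + 1 = 1 from rfl, show (1 : Fin 6) + 1 = 2 from rfl,
    show (2 : Fin 6) + 1 = 3 from rfl, show (3 : Fin 6) + 1 = 4 from rfl,
    show (4 : Fin 6) + 1 = 5 from rfl, show (5 : Fin 6) + 1 = 0 from rfl] at s0 s1 s2 s3 s4 s5
  fin_cases k
  · simp; positivity
  · -- one step back from edge 1 to edge 0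
    calc ‖F (edge x 1) - F (edge x 0)‖ = ‖F (edge x 0) - F (edge x 1)‖ := norm_sub_rev _ _
      _ ≤ 2 * d := s0
      _ ≤ 6 * d := by linarith
  · calc ‖F (edge x 2) - F (edge x 0)‖
          ≤ ‖F (edge x 2) - F (edge x 1)‖ + ‖F (edge x 1) - F (edge x 0)‖ := norm_sub_le_norm_sub_add_norm_sub _ _ _
      _ ≤ 2 * d + 2 * d := add_le_add (by rw [norm_sub_rev]; exact s1) (by rw [norm_sub_rev]; exact s0)
      _ ≤ 6 * d := by linarith
  · calc ‖F (edge x 3) - F (edge x 0)‖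
          ≤ ‖F (edge x 3) - F (edge x 4)‖ + ‖F (edge x 4) - F (edge x 0)‖ := norm_sub_le_norm_sub_add_norm_sub _ _ _
      _ ≤ 2 * d + (‖F (edge x 4) - F (edge x 5)‖ + ‖F (edge x 5) - F (edge x 0)‖) :=
          add_le_add s3 (norm_sub_le_norm_sub_add_norm_sub _ _ _)
      _ ≤ 2 * d + (2 * d + 2 * d) := by linarith [s4, s5]
      _ = 6 * d := by ring
  · calc ‖F (edge x 4) - F (edge x 0)‖
          ≤ ‖F (edge x 4) - F (edge x 5)‖ + ‖F (edge x 5) - F (edge x 0)‖ := norm_sub_le_norm_sub_add_norm_sub _ _ _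
      _ ≤ 2 * d + 2 * d := add_le_add s4 s5
      _ ≤ 6 * d := by linarith
  · calc ‖F (edge x 5) - F (edge x 0)‖ ≤ 2 * d := s5
      _ ≤ 6 * d := by linarith

/-- Registered sub-goal `stub_halfPlaneInputs_starOscillation` of crux stmt-CriticalPhenomena-14004
(line `pick-half-plane`, interior half of `stub_halfPlaneInputs`): the closed form of
`norm_edge_sub_edge_zero_le` — around a hexagon with corners in the domain, any solution of the
vertex relations oscillates by at most six times the largest conjugated star defect.
[cite: DuminilCopinSmirnov2012, Lemma 1] -/
theorem stub_halfPlaneInputs_starOscillation : ∀ (Λ : Finset HexVertex) (F : Sym2 HexVertex → ℂ), SatisfiesVertexRelations Λ F → ∀ (x : Site 2), (∀ j : Fin 6, HexKernel.face x j ∈ Λ) → ∀ (d : ℝ), (∀ j : Fin 6, ‖conjStarSum F x j‖ ≤ d) → ∀ (k : Fin 6), ‖F (HexKernel.edge x k) - F (HexKernel.edge x 0)‖ ≤ 6 * d :=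
  fun _ _ hF x hv _ hd k => norm_edge_sub_edge_zero_le hF x hv hd k

end Summit.CriticalPhenomena.SAWScalingLimit.Theorems.PickHalfPlane.StarDefect
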